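import Mathlib
import Literature.Barriers.NavierStokesRegularity.DyadicInvariantRegionNumerics
import HarnessLib

/-!
# A Barbato–Morandin–Romito region for the Katz–Pavlović chain at scale ratios `b ∈ [1.7, 2]`:
# the numerical inequalities (helper file for crux stmt-NavierStokesRegularity-27057, `--supports`)

Barbato–Morandin–Romito 2011 (Lemma 2.1, the tree's `Dyadic.invariantRegion_le_one`) prove that the
region `A = {0 ≤ x ≤ 1, h(x) ≤ y ≤ g(x)}`, `h(x) = c((x-δ)/(1-δ))⁴`, `g(x) = min(mx + θ₀, 1)`, is
invariant for the consecutive pairs `(Yₙ, Y_{n+1})` of the rescaled positive viscous dyadic chain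
`Ẏₙ = -κₙYₙ + Fₙ(Y²_{n-1} - pYₙY_{n+1})`, `F_{n+1} = LFₙ`, for THEIR constants
`(δ, θ₀, m) = (1/10, 3/5, 3/4)` at the scale ratio `λ = 2` (`p ≈ 2`, `L ≈ 4`). On Tao's lattice at
ratio `b = 1+ε₀` the rescaling `Yₖ = b^{θk}Xₖ` gives `p = b^{5/2-3θ}`, `L = b^{5/2-θ}`, hence
`L ≥ p²` as soon as `θ ≥ 1/2`, and for `θ = 101/200` the region with the RE-TUNED slope `m = 1/2`
(same `δ = 1/10`, `θ₀ = 3/5`, quartic `h`, corner condition `pc = 1`) is invariant whenever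
`p ≥ 42/25`, i.e. for every `b ∈ [17/10, 2]`. This file isolates the two numerical facts this needs,
as inequalities between real numbers (the dynamical argument is the sibling file
`SubOnsagerCeilingDyadicRangeRegion`):

* `top_ineq` — the slanted piece `y = x/2 + 3/5`: `(1/2)xy ≤ (42/25)(y((y-δ)/(1-δ))⁴ - x²)` on
  `x ∈ [0, 4/5]` (a quintic with positive Bernstein coefficients on `[0, 4/5]`);
* `bottom_ineq` — the curved piece `y = h(x)`: for `x ∈ [1/10, 1]`, `u = (x-δ)/(1-δ)`, `p ≥ 42/25`,
  `L ≥ p²`, `pc = 1`: `L(x² - u⁴(cu⁴/2 + 3/5)) - (4c/(1-δ))u³(1 - xu⁴) > 0` (monotone in `p`; at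
  `p = 42/25` a degree-8 polynomial in `u`, positive Bernstein coefficients on `[0,1/2]`, `[1/2,1]`);
* the two inward-pointing lemmas `top_slant_deriv_neg`, `bottom_curve_deriv_neg` in the shape
  consumed by the first-exit argument (the tree's lemmas of the same name with `m = 3/4 ↦ 1/2` and
  the numerical hypotheses `L ≥ 3.972, …` replaced by `42/25 ≤ p`, `p² ≤ L`).

HONEST FRAMING: elementary real inequalities towards a MODEL-lattice statement (rung under the
crux `ForwardTailCeilingKP` of route SubOnsagerCeiling, TL-M2Break); nothing here bears on
Navier–Stokes regularity. [cite: BarbatoMorandinRomito2011, §2 Lemma 2.1, (2.2)–(2.3)]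
-/

noncomputable section

-- the sub-problem namespace `NavierStokesRegularity.NavierStokesRegularity` is the tree's layout (D-0017)
set_option linter.dupNamespace false

namespace Summit.NavierStokesRegularity.NavierStokesRegularity.Theorems.DyadicRange

open Real

/-! ## The slanted piece -/

/-- The quintic `T(x) = (42/25)(y u⁴ - x²) - (1/2)xy`, `y = x/2 + 3/5`, `u = 5(x+1)/9`, expanded,
is non-negative on `[0, 4/5]`: its Bernstein coefficients on that interval are
`≥ 0.015`; `linarith` finds the certificate from the six products `xᵏ(4/5-x)^{5-k} ≥ 0`.
[cite: BarbatoMorandinRomito2011, §2 Lemma 2.1 (2.2)] -/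
theorem top_poly_nonneg {x : ℝ} (hx0 : 0 ≤ x) (hx1 : x ≤ 4 / 5) :
    0 ≤ (70 / 729 : ℝ) + 3589 / 21870 * x - 226091 / 218700 * x ^ 2 + 70 / 81 * x ^ 3 +
      910 / 2187 * x ^ 4 + 175 / 2187 * x ^ 5 := by
  have h1 : 0 ≤ 4 / 5 - x := by linarith
  linarith [pow_nonneg h1 5, mul_nonneg hx0 (pow_nonneg h1 4),
    mul_nonneg (pow_nonneg hx0 2) (pow_nonneg h1 3), mul_nonneg (pow_nonneg hx0 3) (pow_nonneg h1 2),
    mul_nonneg (pow_nonneg hx0 4) h1, pow_nonneg hx0 5]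

/-- **The slanted piece `y = x/2 + 3/5`** (`δ = 1/10`, `θ₀ = 3/5`, `m = 1/2`, quartic `h`, at the
threshold `p = 42/25`): `(1/2)xy ≤ (42/25)(y((y-δ)/(1-δ))⁴ - x²)` for `x ≥ 0`, `y ≤ 1` — the
drain of the upper shell dominates. [cite: BarbatoMorandinRomito2011, §2 Lemma 2.1 (2.2)] -/
theorem top_ineq {x y : ℝ} (hx : 0 ≤ x) (hy : y = 1 / 2 * x + 3 / 5) (hy1 : y ≤ 1) :
    1 / 2 * x * y ≤ 42 / 25 * (y * ((y - 1 / 10) / (9 / 10)) ^ 4 - x ^ 2) := by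
  subst hy
  have hx1 : x ≤ 4 / 5 := by linarith
  have key := top_poly_nonneg hx hx1
  have h18 : (1 / 2 * x + 3 / 5 - 1 / 10) / (9 / 10) = (5 * x + 5) / 9 := by ring
  rw [h18]
  nlinarith [key]

/-! ## The curved bottom piece -/

/-- The bottom polynomial on `[0, 1/2]`: Bernstein coefficients `≥ 0.028`.
[cite: BarbatoMorandinRomito2011, §2 Lemma 2.1 (2.3)] -/
theorem bottom_poly_pos_lo {u : ℝ} (hu0 : 0 ≤ u) (hu1 : u ≤ 1 / 2) :
    (1 / 50 : ℝ) ≤ 441 / 15625 + 7938 / 15625 * u + 35721 / 15625 * u ^ 2 - 500 / 189 * u ^ 3 -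
      5292 / 3125 * u ^ 4 + 50 / 189 * u ^ 7 + 809 / 525 * u ^ 8 := by
  have h1 : 0 ≤ 1 / 2 - u := by linarith
  linarith [pow_nonneg h1 8, mul_nonneg hu0 (pow_nonneg h1 7),
    mul_nonneg (pow_nonneg hu0 2) (pow_nonneg h1 6), mul_nonneg (pow_nonneg hu0 3) (pow_nonneg h1 5),
    mul_nonneg (pow_nonneg hu0 4) (pow_nonneg h1 4), mul_nonneg (pow_nonneg hu0 5) (pow_nonneg h1 3),
    mul_nonneg (pow_nonneg hu0 6) (pow_nonneg h1 2), mul_nonneg (pow_nonneg hu0 7) h1,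
    pow_nonneg hu0 8]

/-- The bottom polynomial on `[1/2, 1]`: Bernstein coefficients `≥ 0.0046`.
[cite: BarbatoMorandinRomito2011, §2 Lemma 2.1 (2.3)] -/
theorem bottom_poly_pos_hi {u : ℝ} (hu0 : 1 / 2 ≤ u) (hu1 : u ≤ 1) :
    (1 / 250 : ℝ) ≤ 441 / 15625 + 7938 / 15625 * u + 35721 / 15625 * u ^ 2 - 500 / 189 * u ^ 3 -
      5292 / 3125 * u ^ 4 + 50 / 189 * u ^ 7 + 809 / 525 * u ^ 8 := by
  have h0 : 0 ≤ u - 1 / 2 := by linarith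
  have h1 : 0 ≤ 1 - u := by linarith
  linarith [pow_nonneg h1 8, mul_nonneg h0 (pow_nonneg h1 7),
    mul_nonneg (pow_nonneg h0 2) (pow_nonneg h1 6), mul_nonneg (pow_nonneg h0 3) (pow_nonneg h1 5),
    mul_nonneg (pow_nonneg h0 4) (pow_nonneg h1 4), mul_nonneg (pow_nonneg h0 5) (pow_nonneg h1 3),
    mul_nonneg (pow_nonneg h0 6) (pow_nonneg h1 2), mul_nonneg (pow_nonneg h0 7) h1,
    pow_nonneg h0 8]

/-- The bottom polynomial is positive on `[0, 1]`. [cite: BarbatoMorandinRomito2011, §2 Lemma 2.1 (2.3)] -/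
theorem bottom_poly_pos {u : ℝ} (hu0 : 0 ≤ u) (hu1 : u ≤ 1) :
    (1 / 250 : ℝ) ≤ 441 / 15625 + 7938 / 15625 * u + 35721 / 15625 * u ^ 2 - 500 / 189 * u ^ 3 -
      5292 / 3125 * u ^ 4 + 50 / 189 * u ^ 7 + 809 / 525 * u ^ 8 := by
  rcases le_or_gt u (1 / 2) with h | h
  · linarith [bottom_poly_pos_lo hu0 h]
  · exact bottom_poly_pos_hi h.le hu1

/-- The bottom polynomial in the variables of BMR (2.3) at the threshold `p = 42/25`
(`p² = 1764/625`, `1/(2p) = 25/84`, `4/((1-δ)p) = 500/189`): for `u ∈ [0,1]`, `x = 1/10 + (9/10)u`,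
`(1764/625)(x² - u⁴((25/84)u⁴ + 3/5)) - (500/189)u³(1 - xu⁴) ≥ 1/250`.
[cite: BarbatoMorandinRomito2011, §2 Lemma 2.1 (2.3)] -/
theorem bottom_bound {u x : ℝ} (hu0 : 0 ≤ u) (hu1 : u ≤ 1) (hx : x = 1 / 10 + 9 / 10 * u) :
    (1 / 250 : ℝ) ≤ 1764 / 625 * (x ^ 2 - u ^ 4 * (25 / 84 * u ^ 4 + 3 / 5)) -
      500 / 189 * u ^ 3 * (1 - x * u ^ 4) := by
  have h := bottom_poly_pos hu0 hu1
  subst hx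
  have : 1764 / 625 * ((1 / 10 + 9 / 10 * u) ^ 2 - u ^ 4 * (25 / 84 * u ^ 4 + 3 / 5)) -
      500 / 189 * u ^ 3 * (1 - (1 / 10 + 9 / 10 * u) * u ^ 4) =
      441 / 15625 + 7938 / 15625 * u + 35721 / 15625 * u ^ 2 - 500 / 189 * u ^ 3 -
      5292 / 3125 * u ^ 4 + 50 / 189 * u ^ 7 + 809 / 525 * u ^ 8 := by ring
  linarith

/-- **The bottom-piece inequality in the form used by the dynamical argument.** For
`x ∈ [δ, 1] = [1/10, 1]`, `u = (x-δ)/(1-δ)`, and coefficients `p ≥ 42/25`, `L ≥ p²`, `pc = 1`: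
`L(x² - u⁴(cu⁴/2 + 3/5)) - (4c/(1-δ))u³(1 - xu⁴) > 0` (monotone in `p`; at `p = 42/25` it is
`bottom_bound`). [cite: BarbatoMorandinRomito2011, §2 Lemma 2.1 (2.3)] -/
theorem bottom_ineq {x L p c : ℝ} (hx0 : 1 / 10 ≤ x) (hx1 : x ≤ 1) (hp : 42 / 25 ≤ p)
    (hL : p ^ 2 ≤ L) (hpc : p * c = 1) :
    0 < L * (x ^ 2 - ((x - 1 / 10) / (9 / 10)) ^ 4 * (1 / 2 * c * ((x - 1 / 10) / (9 / 10)) ^ 4 + 3 / 5)) -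
      4 * c / (9 / 10) * ((x - 1 / 10) / (9 / 10)) ^ 3 * (1 - x * ((x - 1 / 10) / (9 / 10)) ^ 4) := by
  set u : ℝ := (x - 1 / 10) / (9 / 10) with hu
  have hxu : x = 1 / 10 + 9 / 10 * u := by rw [hu]; ring
  have hu0 : 0 ≤ u := by rw [hu]; apply div_nonneg <;> linarith
  have hu1 : u ≤ 1 := by rw [hu, div_le_one (by norm_num)]; linarith
  have hux : u ≤ x := by linarith
  have hp0 : 0 < p := by linarith
  have hc0 : 0 < c := by
    have : 0 < p * c := by rw [hpc]; exact one_pos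
    exact pos_of_mul_pos_right this hp0.le
  -- `c = 1/p ≤ 25/42`
  have hc1 : c ≤ 25 / 42 := by
    have : 42 / 25 * c ≤ p * c := mul_le_mul_of_nonneg_right hp hc0.le
    rw [hpc] at this
    linarith
  have hu4 : u ^ 4 ≤ x ^ 2 := by
    have h1 : u ^ 4 ≤ u ^ 2 := by nlinarith [pow_nonneg hu0 2, mul_le_one₀ hu1 hu0 hu1]
    have h2 : u ^ 2 ≤ x ^ 2 := pow_le_pow_left₀ hu0 hux 2
    linarith
  have hu8 : u ^ 8 ≤ x ^ 2 := by
    have : u ^ 8 ≤ u ^ 4 := by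
      have h44 : u ^ 8 = u ^ 4 * u ^ 4 := by ring
      rw [h44]; exact mul_le_of_le_one_right (pow_nonneg hu0 4) (pow_le_one₀ hu0 hu1)
    linarith
  -- the bracket is non-negative (uniformly in `c ≤ 25/42`)
  have hbr : 0 ≤ x ^ 2 - u ^ 4 * (1 / 2 * c * u ^ 4 + 3 / 5) := by
    have e : x ^ 2 - u ^ 4 * (1 / 2 * c * u ^ 4 + 3 / 5) = x ^ 2 - 3 / 5 * u ^ 4 - 1 / 2 * c * u ^ 8 := by
      ring
    rw [e]
    nlinarith [mul_nonneg hc0.le (pow_nonneg hu0 8)]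
  have hB : 0 ≤ 1 - x * u ^ 4 := by
    have : u ^ 4 ≤ 1 := pow_le_one₀ hu0 hu1
    nlinarith [pow_nonneg hu0 4]
  have hu3 : 0 ≤ u ^ 3 := pow_nonneg hu0 3
  have key := bottom_bound hu0 hu1 hxu
  -- monotone replacement: `L ≥ p² ≥ (42/25)²`, `c ≤ 25/42`
  have hL' : (1764 / 625 : ℝ) ≤ L := by nlinarith
  have e1 : 1764 / 625 * (x ^ 2 - u ^ 4 * (25 / 84 * u ^ 4 + 3 / 5)) ≤
      L * (x ^ 2 - u ^ 4 * (1 / 2 * c * u ^ 4 + 3 / 5)) := by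
    have h1 : x ^ 2 - u ^ 4 * (25 / 84 * u ^ 4 + 3 / 5) ≤ x ^ 2 - u ^ 4 * (1 / 2 * c * u ^ 4 + 3 / 5) := by
      nlinarith [pow_nonneg hu0 8, pow_nonneg hu0 4]
    calc 1764 / 625 * (x ^ 2 - u ^ 4 * (25 / 84 * u ^ 4 + 3 / 5))
        ≤ 1764 / 625 * (x ^ 2 - u ^ 4 * (1 / 2 * c * u ^ 4 + 3 / 5)) :=
          mul_le_mul_of_nonneg_left h1 (by norm_num)
      _ ≤ L * (x ^ 2 - u ^ 4 * (1 / 2 * c * u ^ 4 + 3 / 5)) := mul_le_mul_of_nonneg_right hL' hbr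
  have e2 : 4 * c / (9 / 10) * u ^ 3 * (1 - x * u ^ 4) ≤ 500 / 189 * u ^ 3 * (1 - x * u ^ 4) := by
    have : 4 * c / (9 / 10) ≤ 500 / 189 := by
      rw [div_le_iff₀ (by norm_num)]; linarith
    exact mul_le_mul_of_nonneg_right (mul_le_mul_of_nonneg_right this hu3) hB
  linarith

/-! ## Inward pointing on the two curved pieces of the boundary (pure inequalities) -/

/-- **Slanted top piece `y = x/2 + 3/5`**: the derivative of `Y_{n+1} - Yₙ/2 - 3/5` is strictly
negative there. Viscous part `-κ_{n+1}y + κₙx/2 ≤ -κₙ(y - x/2) < 0`; inviscid part `≤ 0` by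
`z ≥ h(y)`, `pc = 1`, `L ≥ p²`, `p ≥ 42/25` and `top_ineq`.
[cite: BarbatoMorandinRomito2011, §2 Lemma 2.1 (proof, piece n₂, (2.2))] -/
theorem top_slant_deriv_neg {κn κn1 Fn L p c x y z w : ℝ} (hκn : 0 < κn) (hκmono : κn ≤ κn1)
    (hFn : 0 < Fn) (hp : 42 / 25 ≤ p) (hpL : p ^ 2 ≤ L) (hpc : p * c = 1) (hx : 0 ≤ x)
    (hy : y = 1 / 2 * x + 3 / 5) (hy1 : y ≤ 1)
    (hz : c * ((y - 1 / 10) / (9 / 10)) ^ 4 ≤ z) :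
    (-κn1 * y + L * Fn * (x ^ 2 - p * y * z)) - 1 / 2 * (-κn * x + Fn * (w ^ 2 - p * x * y)) < 0 := by
  have hy0 : 0 < y := by rw [hy]; positivity
  have hp0 : 0 < p := by linarith
  have hL : 0 < L := lt_of_lt_of_le (by positivity) hpL
  -- viscous part
  have hv : -κn1 * y + 1 / 2 * (κn * x) < 0 := by
    have : κn * y ≤ κn1 * y := mul_le_mul_of_nonneg_right hκmono hy0.le
    rw [hy] at this ⊢
    nlinarith
  -- inviscid part: `L (x² - p y z) + (1/2) p x y ≤ 0`
  have hψ := top_ineq hx hy hy1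
  set q : ℝ := y * ((y - 1 / 10) / (9 / 10)) ^ 4 with hq
  have hu4 : q ≤ p * y * z := by
    have := mul_le_mul_of_nonneg_left hz (mul_nonneg hp0.le hy0.le)
    calc q = p * y * (c * ((y - 1 / 10) / (9 / 10)) ^ 4) := by
          rw [show p * y * (c * ((y - 1 / 10) / (9 / 10)) ^ 4) =
            (p * c) * (y * ((y - 1 / 10) / (9 / 10)) ^ 4) by ring, hpc, one_mul]
      _ ≤ p * y * z := this
  have hneg : x ^ 2 - q ≤ 0 := by nlinarith [mul_nonneg hx hy0.le]
  have hi : L * (x ^ 2 - p * y * z) + 1 / 2 * (p * x * y) ≤ 0 := by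
    have h1 : L * (x ^ 2 - p * y * z) ≤ L * (x ^ 2 - q) := by
      apply mul_le_mul_of_nonneg_left _ hL.le; linarith
    have h2 : L * (x ^ 2 - q) ≤ p ^ 2 * (x ^ 2 - q) := by nlinarith
    have h3 : p ^ 2 * (x ^ 2 - q) + 1 / 2 * (p * x * y) = p * (p * (x ^ 2 - q) + 1 / 2 * x * y) := by
      ring
    have h4 : p * (x ^ 2 - q) ≤ 42 / 25 * (x ^ 2 - q) := by nlinarith
    have h5 : 42 / 25 * (x ^ 2 - q) + 1 / 2 * x * y ≤ 0 := by rw [hq]; linarith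
    have h6 : p * (p * (x ^ 2 - q) + 1 / 2 * x * y) ≤ 0 :=
      mul_nonpos_of_nonneg_of_nonpos hp0.le (by linarith)
    linarith
  have hw : 0 ≤ Fn * w ^ 2 := mul_nonneg hFn.le (sq_nonneg w)
  have key : (-κn1 * y + L * Fn * (x ^ 2 - p * y * z)) - 1 / 2 * (-κn * x + Fn * (w ^ 2 - p * x * y)) =
      (-κn1 * y + 1 / 2 * (κn * x)) + Fn * (L * (x ^ 2 - p * y * z) + 1 / 2 * (p * x * y)) -
        1 / 2 * (Fn * w ^ 2) := by ring
  rw [key]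
  nlinarith [mul_nonpos_of_nonneg_of_nonpos hFn.le hi]

/-- **Curved bottom piece `y = h(x) = c((x-δ)/(1-δ))⁴`, `x > δ`**: the derivative of
`h(Yₙ) - Y_{n+1}` is strictly negative there. Viscous part `≤ 0` since `xh'(x) ≥ 4h(x)` and
`κ_{n+1} ≤ 4κₙ`; inviscid part `< 0` by `z ≤ y/2 + 3/5`, `w² ≤ 1`, `pc = 1` and `bottom_ineq`.
[cite: BarbatoMorandinRomito2011, §2 Lemma 2.1 (proof, piece n₅, (2.3))] -/
theorem bottom_curve_deriv_neg {κn κn1 Fn L p c x y z w : ℝ} (hκn : 0 ≤ κn) (hκ4 : κn1 ≤ 4 * κn)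
    (hFn : 0 < Fn) (hp : 42 / 25 ≤ p) (hpL : p ^ 2 ≤ L) (hpc : p * c = 1) (hx0 : 1 / 10 ≤ x)
    (hx1 : x ≤ 1) (hy : y = c * ((x - 1 / 10) / (9 / 10)) ^ 4) (hz : z ≤ 1 / 2 * y + 3 / 5)
    (hw0 : 0 ≤ w) (hw1 : w ≤ 1) :
    4 * c * ((x - 1 / 10) / (9 / 10)) ^ 3 / (9 / 10) * (-κn * x + Fn * (w ^ 2 - p * x * y)) -
      (-κn1 * y + L * Fn * (x ^ 2 - p * y * z)) < 0 := by
  have hp0 : 0 < p := by linarith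
  have hc0 : 0 < c := by
    have : 0 < p * c := by rw [hpc]; exact one_pos
    exact pos_of_mul_pos_right this hp0.le
  set u : ℝ := (x - 1 / 10) / (9 / 10) with hu
  obtain ⟨hu0, hu1⟩ := Literature.Barriers.NavierStokesRegularity.Dyadic.sub_delta_div_mem hx0 hx1
  have hy0 : 0 ≤ y := by rw [hy]; positivity
  have hu3 : 0 ≤ u ^ 3 := pow_nonneg hu0 3
  -- viscous part: `h'(x) κₙ x ≥ 4 κₙ h(x) ≥ κ_{n+1} h(x)`
  have hv : 0 ≤ 4 * c * u ^ 3 / (9 / 10) * (κn * x) - κn1 * y := by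
    have hxu : x / (9 / 10) = u + (1 / 10) / (9 / 10) := by rw [hu]; ring
    have h2 : κn1 * y ≤ 4 * κn * y := mul_le_mul_of_nonneg_right hκ4 hy0
    have h3 : 4 * κn * y ≤ 4 * κn * (c * u ^ 3) * (x / (9 / 10)) := by
      rw [hy, hxu]
      have : c * u ^ 4 ≤ c * u ^ 3 * (u + 1 / 10 / (9 / 10)) := by
        have : (0 : ℝ) ≤ c * u ^ 3 * (1 / 10 / (9 / 10)) := by positivity
        nlinarith
      have := mul_le_mul_of_nonneg_left this (by positivity : (0 : ℝ) ≤ 4 * κn)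
      linarith [this]
    have h1 : 4 * c * u ^ 3 / (9 / 10) * (κn * x) = 4 * κn * (c * u ^ 3) * (x / (9 / 10)) := by ring
    linarith
  -- inviscid part
  have hyu : p * y = u ^ 4 := by
    rw [hy, show p * (c * u ^ 4) = (p * c) * u ^ 4 by ring, hpc, one_mul]
  have hxy : p * x * y = x * u ^ 4 := by rw [mul_comm p x, mul_assoc, hyu]
  have hB : 0 ≤ 1 - x * u ^ 4 := by
    have : u ^ 4 ≤ 1 := pow_le_one₀ hu0 hu1
    nlinarith [pow_nonneg hu0 4]
  have hnum := bottom_ineq (L := L) hx0 hx1 hp hpL hpc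
  have h1 : x ^ 2 - u ^ 4 * (1 / 2 * c * u ^ 4 + 3 / 5) ≤ x ^ 2 - p * y * z := by
    have : p * y * z ≤ u ^ 4 * (1 / 2 * y + 3 / 5) := by
      rw [hyu]; exact mul_le_mul_of_nonneg_left hz (pow_nonneg hu0 4)
    have hyc : u ^ 4 * (1 / 2 * y + 3 / 5) = u ^ 4 * (1 / 2 * c * u ^ 4 + 3 / 5) := by rw [hy]; ring
    linarith
  have h2 : w ^ 2 - p * x * y ≤ 1 - x * u ^ 4 := by rw [hxy]; nlinarith
  have hL0 : 0 ≤ L := le_trans (sq_nonneg p) hpL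
  have key : 4 * c * u ^ 3 / (9 / 10) * (-κn * x + Fn * (w ^ 2 - p * x * y)) -
      (-κn1 * y + L * Fn * (x ^ 2 - p * y * z)) =
      -(4 * c * u ^ 3 / (9 / 10) * (κn * x) - κn1 * y) -
        Fn * (L * (x ^ 2 - p * y * z) - 4 * c / (9 / 10) * u ^ 3 * (w ^ 2 - p * x * y)) := by ring
  rw [key]
  have h3 : L * (x ^ 2 - u ^ 4 * (1 / 2 * c * u ^ 4 + 3 / 5)) - 4 * c / (9 / 10) * u ^ 3 * (1 - x * u ^ 4) ≤
      L * (x ^ 2 - p * y * z) - 4 * c / (9 / 10) * u ^ 3 * (w ^ 2 - p * x * y) := by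
    have e1 := mul_le_mul_of_nonneg_left h1 hL0
    have e2 := mul_le_mul_of_nonneg_left h2 (by positivity : (0 : ℝ) ≤ 4 * c / (9 / 10) * u ^ 3)
    linarith
  have h4 : 0 < L * (x ^ 2 - p * y * z) - 4 * c / (9 / 10) * u ^ 3 * (w ^ 2 - p * x * y) :=
    hnum.trans_le h3
  nlinarith [mul_pos hFn h4]

end Summit.NavierStokesRegularity.NavierStokesRegularity.Theorems.DyadicRange

end
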